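import Summits.QuantumFields.YangMills.Theorems.LuscherReductionDressedRitzPlateauLevelZero
import Summits.QuantumFields.YangMills.Theorems.LuscherReductionDressedRitzPlateauCertificates
import Summits.QuantumFields.YangMills.Theorems.FemtoTransferGapWeinstein
import HarnessLib

/-!
# Route `LuscherReduction`, item `DressedRitz` (stmt-QuantumFields-20205) — LOCATED LEVELS: what the residual-Gram clause (ii′) pins about the
# RUNNING spectrum without any no-intruder hypothesis (Weinstein enclosure at the rate `Λ³/L²`)

Prover seat ymfull-r2b-prover-1 (cell ym-gapexp, R590-ym item (10)), `--supports stmt-QuantumFields-20205 --as helper`.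

WHAT.  Let `φ₀ … φ_k` be a family as in the level-`k` slice `KTGen.DressedRitzAt k` of item 20205 (physical, `l2`-orthonormal, Ritz values
`m_i = ⟨φ_i,K_βφ_i⟩`, residual-Gram clause (ii′) `‖Σ c_i r_i‖² ≤ C(Λ³/L²)m₀² Σ c_i²`, top capture).  Taking `c = e_i` in (ii′) gives `‖r_i‖² ≤ C(Λ³/L²)m₀²`,
and the tree's Weinstein enclosure (`FemtoTransferGapWeinstein`, `Weinstein.inclusion_ritz`) turns this into a LOCATED RUNNING LEVEL:

* ★ `KTGen.locatedLevel_of_residualGram` (fixed lattice): for a physical family with the residual-Gram bound at constant `ϱ` and a member with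
  `m_i > 0`, SOME `λ_j = levelValue su2Rep L β j` has `(λ_j − m_i)²·m_i ≤ ϱ·λ₀`;
* ★★ `KTGen.locatedLevels_of_dressedRitzAt : DressedRitzAt k → …` — along the femto window the slice's family has, for EVERY `i ≤ k`, a running level with
  `(λ_j − m_i)²·m_i ≤ C·(Λ³/L²)·m₀²·λ₀`, together with `m_i > 0` (discharged here from the closed crux ONE `oneSiteLevels_proof`, `levelValue_antitone`
  and clause (e)) and `λ₀ ≤ e^{ηΛ/L}m₀` (clause (g) at the exact top eigenvector); i.e. `|λ_j/m₀ − m_i/m₀| ≤ √(C e^{ηΛ/L} m₀/m_i)·Λ^{3/2}/L` —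
  FINER than the zero-mode level spacing `≍ Λ/L` as `Λ → 0`.

WHY it matters for 20205 (KT door of skeleton KTR r8).  This is the index-free «existence half» of the handover that item 20205 ALONE delivers: every
Ritz value of the family is shadowed by a true zero-flux level of the `L`-lattice at relative precision `Λ^{3/2}/L`; the Kato–Temple door
(`KTDoorR3.katoTempleDoorR3`) upgrades this to the INDEXED two-sided statement RED only with the no-intruder input.  It also records why the exponent
in (ii′) is `3`: a residual rate `Λ^a/L²` locates levels at radius `Λ^{a/2}/L`, which resolves the spacing `Λ/L` iff `a > 2` (the instrument question
«`Λ³/L²` vs `Λ²/L`» of cell ym-gapexp: at `Λ²/L` nothing is located).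

HONEST FRAMING: fixed-lattice spectral bookkeeping on the CONDITIONAL femto rung R2b1 (finite volume); a CONSEQUENCE of item 20205, not a proof of
it; nothing here bears on infinite volume, the continuum limit or the Clay mass gap — the Yang–Mills mass gap is NOT proved.
References: T. Kato, J. Phys. Soc. Japan 4 (1949) 334 [cite: Kato1949, Lemma 1]; Reed–Simon IV [cite: ReedSimonIV1978, Thm. XIII.1];
M. Lüscher, NPB 219 (1983) 233 [cite: Luscher1983, §3].
-/

set_option autoImplicit false

noncomputable section

open MeasureTheory Filter Topology Real
open Literature.MathematicalPhysics.QuantumFieldTheory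
open Literature.MathematicalPhysics.QuantumLattice
open Literature.Analysis.OperatorTheory.YMMatrixModel
open scoped BigOperators

namespace Summit.QuantumFields.YangMills.Theorems.FemtoTransferGap

open Summit.QuantumFields.YangMills.Theorems.FemtoTransferGap.KTRCalibration

/-! ## §1 Fixed lattice: one located level per Ritz vector from the residual-Gram clause -/

/-- A single coefficient vector in the residual-Gram clause: `Σ_l (e_i)_l • r_l = r_i`. [folklore] -/
theorem KTGen.sum_single_smul {L : ℕ} {k : ℕ} (r : Fin (k + 1) → (GaugeConfig 3 L SU2 → ℝ)) (i : Fin (k + 1)) :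
    ∑ l, (Pi.single i (1 : ℝ) : Fin (k + 1) → ℝ) l • r l = r i := by
  rw [Finset.sum_eq_single i (fun l _ hl => by rw [Pi.single_eq_of_ne hl, zero_smul]) (fun h => absurd (Finset.mem_univ i) h),
    Pi.single_eq_same, one_smul]

/-- `Σ_l (e_i)_l² = 1`. [folklore] -/
theorem KTGen.sum_single_sq {k : ℕ} (i : Fin (k + 1)) : ∑ l, (Pi.single i (1 : ℝ) : Fin (k + 1) → ℝ) l ^ 2 = 1 := by
  rw [Finset.sum_eq_single i (fun l _ hl => by rw [Pi.single_eq_of_ne hl]; ring) (fun h => absurd (Finset.mem_univ i) h),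
    Pi.single_eq_same, one_pow]

/-- ★ **One located running level per Ritz vector** (fixed lattice, `β > 0`): if a physical family satisfies the residual-Gram clause
`‖Σ c_l r_l‖² ≤ ϱ Σ c_l²` (`r_l = K_βφ_l − m_lφ_l`, `m_l = qform su2Rep β φ_l φ_l`) and `m_i > 0`, then some `λ_j = levelValue su2Rep L β j` has
`(λ_j − m_i)²·m_i ≤ ϱ·λ₀` (Weinstein enclosure `Weinstein.inclusion_ritz` at `c = e_i`). [cite: Kato1949, Lemma 1] [cite: ReedSimonIV1978, Thm. XIII.1] -/
theorem KTGen.locatedLevel_of_residualGram {L : ℕ} [NeZero L] {β : ℝ} (hβ : 0 < β) {k : ℕ}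
    {φ : Fin (k + 1) → (GaugeConfig 3 L SU2 → ℝ)} (hφ : ∀ i, IsPhys (φ i)) {ϱ : ℝ}
    (hres : ∀ c : Fin (k + 1) → ℝ,
      l2 (∑ i, c i • (transferApply β (φ i) - qform su2Rep β (φ i) (φ i) • φ i))
         (∑ i, c i • (transferApply β (φ i) - qform su2Rep β (φ i) (φ i) • φ i)) ≤ ϱ * ∑ i, c i ^ 2)
    (i : Fin (k + 1)) (hpos : 0 < qform su2Rep β (φ i) (φ i)) :
    ∃ j : ℕ, (levelValue su2Rep L β j - qform su2Rep β (φ i) (φ i)) ^ 2 * qform su2Rep β (φ i) (φ i) ≤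
      ϱ * levelValue su2Rep L β 0 := by
  obtain ⟨j, hj⟩ := Weinstein.inclusion_ritz hβ (hφ i) hpos
  refine ⟨j, hj.trans ?_⟩
  have h := hres (Pi.single i 1)
  rw [KTGen.sum_single_smul, KTGen.sum_single_sq, mul_one] at h
  exact mul_le_mul_of_nonneg_right h (levelValue_zero_su2Rep_pos L β).le

/-! ## §2 ★★ Along the femto window: the located levels of the slice `DressedRitzAt k` -/

/-- ★★ **LOCATED LEVELS of item 20205's level-`k` slice.**  If `DressedRitzAt k` holds then for every `η > 0`, eventually in the femto window, the
slice's family `φ₀ … φ_k` (physical, orthonormal, position clauses (e), top capture (g) — re-exported) has STRICTLY POSITIVE Ritz values, captures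
the top `λ₀ ≤ e^{ηΛ/L} m₀`, and EVERY Ritz value `m_i` is shadowed by a running zero-flux level: `∃ j, (λ_j − m_i)²·m_i ≤ C·(Λ³/L²)·m₀²·λ₀`
(index-free existence half of the handover; no no-intruder input). [cite: Kato1949, Lemma 1] [cite: Luscher1983, §3] -/
theorem KTGen.locatedLevels_of_dressedRitzAt {k : ℕ} (h : KTGen.DressedRitzAt k) :
    ∀ η : ℝ, 0 < η → ∃ C lam0 : ℝ, 0 < lam0 ∧ ∀ lam : ℝ, 0 < lam → lam ≤ lam0 →
      ∃ L0 : ℕ, ∀ (L : ℕ) [NeZero L], L0 ≤ L → ∀ β : ℝ, InFemtoWindow lam β L →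
        ∃ φ : Fin (k + 1) → (GaugeConfig 3 L SU2 → ℝ),
          (∀ i, IsPhys (φ i)) ∧
          (∀ i l, l2 (φ i) (φ l) = if i = l then 1 else 0) ∧
          (∀ j : Fin (k + 1),
            qform su2Rep β (φ j) (φ j) * levelValue su2Rep 1 (oneSiteCoupling β L) 0 ≤
                Real.exp (C * luscherLambda β L ^ 2 / L) *
                  (levelValue su2Rep 1 (oneSiteCoupling β L) j * qform su2Rep β (φ 0) (φ 0)) ∧
              levelValue su2Rep 1 (oneSiteCoupling β L) j * qform su2Rep β (φ 0) (φ 0) ≤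
                Real.exp (C * luscherLambda β L ^ 2 / L) *
                  (qform su2Rep β (φ j) (φ j) * levelValue su2Rep 1 (oneSiteCoupling β L) 0)) ∧
          (∀ ψ : GaugeConfig 3 L SU2 → ℝ, IsPhys ψ →
            qform su2Rep β ψ ψ ≤ Real.exp (η * luscherLambda β L / L) * qform su2Rep β (φ 0) (φ 0) * l2 ψ ψ) ∧
          (∀ i : Fin (k + 1), 0 < qform su2Rep β (φ i) (φ i)) ∧
          levelValue su2Rep L β 0 ≤ Real.exp (η * luscherLambda β L / L) * qform su2Rep β (φ 0) (φ 0) ∧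
          (∀ i : Fin (k + 1), ∃ j : ℕ,
            (levelValue su2Rep L β j - qform su2Rep β (φ i) (φ i)) ^ 2 * qform su2Rep β (φ i) (φ i) ≤
              C * (luscherLambda β L ^ 3 / (L : ℝ) ^ 2) * qform su2Rep β (φ 0) (φ 0) ^ 2 * levelValue su2Rep L β 0) := by
  intro η hη
  obtain ⟨C, lam0, hlam0, hC⟩ := h η hη
  -- crux ONE at level `k`: `μ₀(B) > 0` and the lower law `μ_k(B) ≥ e^{−(…)}μ₀(B) > 0` for `B ≥ B₀`
  obtain ⟨C1, B0, hB0⟩ := oneSiteLevels_proof k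
  refine ⟨C, min lam0 (min 1 (1 / (4 * max B0 1))), lt_min hlam0 (lt_min one_pos (by positivity)), fun lam hlam hle => ?_⟩
  have hle0 : lam ≤ lam0 := hle.trans (min_le_left _ _)
  have hle1 : lam ≤ 1 := hle.trans ((min_le_right _ _).trans (min_le_left _ _))
  have hleB : lam ≤ 1 / (4 * max B0 1) := hle.trans ((min_le_right _ _).trans (min_le_right _ _))
  obtain ⟨L0, hL0⟩ := hC lam hlam hle0
  refine ⟨L0, fun L _ hL β hW => ?_⟩
  obtain ⟨φ, hφ, hon, hdiag, hanti, hpos, hres, htop⟩ := hL0 L hL β hW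
  have hβ1 : (1 : ℝ) ≤ β := hW.1
  have hβ : (0 : ℝ) < β := one_pos.trans_le hβ1
  set B := oneSiteCoupling β L with hBdef
  have hBge : B0 ≤ B := oneSiteCoupling_ge_of_small_level hlam hle1 hleB hW
  have hBpos : 0 < B := by
    have h1 : 1 / (4 * lam ^ 3) ≤ B := oneSiteCoupling_ge_of_window hlam hW
    exact lt_of_lt_of_le (by positivity) h1
  obtain ⟨hμ0, -, hμk⟩ := hB0 B hBge
  -- `μ_i > 0` for every `i ≤ k`
  have hμpos : ∀ i : Fin (k + 1), 0 < levelValue su2Rep 1 B i := by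
    intro i
    have hki : levelValue su2Rep 1 B k ≤ levelValue su2Rep 1 B i :=
      levelValue_antitone (L := 1) hBpos.le (Nat.le_of_lt_succ i.isLt)
    exact lt_of_lt_of_le (lt_of_lt_of_le (by positivity) hμk) hki
  -- top capture at the exact top eigenvector: `λ₀ ≤ e^{ηΛ/L} m₀`, hence `m₀ > 0`
  obtain ⟨ψ, hψ, hψ1, hKψ⟩ := KTGen.exists_unit_top_eigenvector (L := L) hβ.le
  have hqψ : qform su2Rep β ψ ψ = levelValue su2Rep L β 0 := by
    rw [qform_eq_l2_transferApply, hKψ, l2_comm, l2_smul_left, hψ1, mul_one]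
  have hcap : levelValue su2Rep L β 0 ≤ Real.exp (η * luscherLambda β L / L) * qform su2Rep β (φ 0) (φ 0) := by
    have := htop ψ hψ
    rw [hqψ, hψ1, mul_one] at this
    exact this
  have hl0 : 0 < levelValue su2Rep L β 0 := levelValue_zero_su2Rep_pos L β
  have hm0 : 0 < qform su2Rep β (φ 0) (φ 0) := by
    by_contra hneg
    push Not at hneg
    have : Real.exp (η * luscherLambda β L / L) * qform su2Rep β (φ 0) (φ 0) ≤ 0 :=
      mul_nonpos_of_nonneg_of_nonpos (Real.exp_pos _).le hneg
    linarith
  -- `m_i > 0` from clause (e) (lower half) and `μ_i, m₀ > 0`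
  have hmpos : ∀ i : Fin (k + 1), 0 < qform su2Rep β (φ i) (φ i) := by
    intro i
    obtain ⟨-, hlo⟩ := hpos i
    have hlhs : 0 < levelValue su2Rep 1 B i * qform su2Rep β (φ 0) (φ 0) := mul_pos (hμpos i) hm0
    have hrhs : 0 < Real.exp (C * luscherLambda β L ^ 2 / L) * (qform su2Rep β (φ i) (φ i) * levelValue su2Rep 1 B 0) :=
      lt_of_lt_of_le hlhs hlo
    have h1 : 0 < qform su2Rep β (φ i) (φ i) * levelValue su2Rep 1 B 0 :=
      pos_of_mul_pos_right hrhs (Real.exp_pos _).le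
    exact pos_of_mul_pos_left h1 hμ0.le
  refine ⟨φ, hφ, hon, hpos, htop, hmpos, hcap, fun i => ?_⟩
  obtain ⟨j, hj⟩ := KTGen.locatedLevel_of_residualGram hβ hφ hres i (hmpos i)
  exact ⟨j, hj⟩

/-- **Corollary for the item itself**: `DressedRitz` (stmt-QuantumFields-20205, BY NAME) implies the located-levels statement at every level.
[cite: Kato1949, Lemma 1] [cite: Luscher1983, §3] -/
theorem KTGen.locatedLevels_of_dressedRitz (h : Summit.QuantumFields.YangMills.Theses.LuscherReduction.DressedRitz) (k : ℕ) :
    ∀ η : ℝ, 0 < η → ∃ C lam0 : ℝ, 0 < lam0 ∧ ∀ lam : ℝ, 0 < lam → lam ≤ lam0 →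
      ∃ L0 : ℕ, ∀ (L : ℕ) [NeZero L], L0 ≤ L → ∀ β : ℝ, InFemtoWindow lam β L →
        ∃ φ : Fin (k + 1) → (GaugeConfig 3 L SU2 → ℝ),
          (∀ i, IsPhys (φ i)) ∧
          (∀ i l, l2 (φ i) (φ l) = if i = l then 1 else 0) ∧
          (∀ j : Fin (k + 1),
            qform su2Rep β (φ j) (φ j) * levelValue su2Rep 1 (oneSiteCoupling β L) 0 ≤
                Real.exp (C * luscherLambda β L ^ 2 / L) *
                  (levelValue su2Rep 1 (oneSiteCoupling β L) j * qform su2Rep β (φ 0) (φ 0)) ∧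
              levelValue su2Rep 1 (oneSiteCoupling β L) j * qform su2Rep β (φ 0) (φ 0) ≤
                Real.exp (C * luscherLambda β L ^ 2 / L) *
                  (qform su2Rep β (φ j) (φ j) * levelValue su2Rep 1 (oneSiteCoupling β L) 0)) ∧
          (∀ ψ : GaugeConfig 3 L SU2 → ℝ, IsPhys ψ →
            qform su2Rep β ψ ψ ≤ Real.exp (η * luscherLambda β L / L) * qform su2Rep β (φ 0) (φ 0) * l2 ψ ψ) ∧
          (∀ i : Fin (k + 1), 0 < qform su2Rep β (φ i) (φ i)) ∧
          levelValue su2Rep L β 0 ≤ Real.exp (η * luscherLambda β L / L) * qform su2Rep β (φ 0) (φ 0) ∧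
          (∀ i : Fin (k + 1), ∃ j : ℕ,
            (levelValue su2Rep L β j - qform su2Rep β (φ i) (φ i)) ^ 2 * qform su2Rep β (φ i) (φ i) ≤
              C * (luscherLambda β L ^ 3 / (L : ℝ) ^ 2) * qform su2Rep β (φ 0) (φ 0) ^ 2 * levelValue su2Rep L β 0) :=
  KTGen.locatedLevels_of_dressedRitzAt (KTGen.dressedRitz_iff_forall_dressedRitzAt.mp h k)

end Summit.QuantumFields.YangMills.Theorems.FemtoTransferGap

end
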